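import Summits.BirchSwinnertonDyer.BirchSwinnertonDyer.Theorems.EdixhovenFibreFiveSevenStarredOptimalManinUnitFiveSevenOrdinaryCellsModels
import Literature.NumberTheory.PAdicHodge.CMFibreGoodOrdinaryDataAnyPrime
import HarnessLib

/-!
# The good `𝒪_D`-MODEL DATA of a potentially good ORDINARY curve over `K_{v′}` at ANY prime `p ≥ 5` — the per-cell inputs of the unit-root frame,
# keyed to the ordinary PATTERN + Deuring's congruence instead of `p ∈ {5, 7}` (route `EdixhovenFibreFiveSeven`, line `kato-lever`; seat `bsd-line-edix-p1` g33, LEAD)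

HONEST FRAMING. ONE tool theorem (no definition, no named fact, no instance, no `sorry`); helper `--supports` crux TDS11 `TwistDegreeStepOrdinary`
(stmt-BirchSwinnertonDyer-22228, the `p ≥ 11` (G)-ordinary residue) whose conditional closer of record (`…TwistDegreeStepOrdinaryOfReciprocityLaw`, g18)
takes Kato's explicit reciprocity law [REC-tower] (cite-only) as a hypothesis. Nothing is closed; BSD / TDS11 are NOT proved by this.

WHAT. `…OrdinaryCellsModels.exists_goodModelData_of_ordinary_numerology` (edix-p4 g29) VERBATIM — statement and proof — with its two `p`-specific
hypotheses `h5 : p = 5 → r₄ = 0 ∧ t₄ = 0 ∧ 0 < t₆`, `h7 : p = 7 → r₆ = 0 ∧ t₆ = 0 ∧ 0 < t₄` replaced by the prime-free ORDINARY PATTERN with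
DEURING's congruence, `hpat : (r₄ = 0 ∧ t₄ = 0 ∧ 0 < t₆ ∧ p ≡ 1 (mod 4)) ∨ (r₆ = 0 ∧ t₆ = 0 ∧ 0 < t₄ ∧ p ≡ 1 (mod 3))` (CM fibre `y² = x³ + a x`,
`j = 1728`, resp. `y² = x³ + b`, `j = 0`), and `p ∈ {5, 7}` replaced by `5 ≤ p`. The five `E₀`-facts and the ordinary reduction of the `𝒪_F`-model now
come from `Literature/NumberTheory/PAdicHodge/CMFibreGoodOrdinaryDataAnyPrime` (this seat; Deuring's criterion for `j ∈ {0, 1728}` in explicit form,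
`EllipticCurves/HasseInvariantJZeroJ1728`). At `p = 5` (`5 ≡ 1 mod 4`) / `p = 7` (`7 ≡ 1 mod 3`) this is the original; at `p ≥ 11` it serves the
(G)-ORDINARY potentially good cells, where (G)-ordinarity gives `e ∣ p − 1` (`TeichmullerTwistDescentTameExponent.semistabilityIndex_dvd_sub_one`),
i.e. `p ≡ 1 (mod 4)` on the `e = 4` cells (`ord_p Δ_min ∈ {3, 9}`) and `p ≡ 1 (mod 3)` on the `e ∈ {3, 6}` cells (`ord_p Δ_min ∈ {2, 4, 8, 10}`).

* ★★★ `exists_goodModelData_of_ordinary_numerology_anyPrime`.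

NEXT (this lane): `localFormula_of_ordinary_numerology` at any `p ≥ 5` (the capstone `ordinaryCapstone_of_numerology` is already `p ≠ 2`), the
(G)-ordinary cells at `p ≥ 11` by `TypeGOrd`, REC at their cyclotomic towers, and TDS11 ⟸ {modularity, P1-bar}.

References: [SilvermanAEC2009] VII.5.5, IV.4.4, V.1.1, V.4.1, Ex. V.4.4–4.5; [SilvermanATAEC1994] IV Table 4.1; [Serre1972] §1.11.
-/

set_option autoImplicit false
-- single-conjunct summit: `Summit.BirchSwinnertonDyer.BirchSwinnertonDyer.…` repeats the name by design
set_option linter.dupNamespace false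

noncomputable section

open Field Function ValuativeRel WittVector NumberField IsDedekindDomain Polynomial
open scoped NumberField Topology Classical NNReal
open Literature.NumberTheory.PAdicHodge Literature.NumberTheory.GaloisRepresentations
  Literature.NumberTheory.GaloisRepresentations.IsNonarchimedeanLocalField Literature.NumberTheory.GaloisRepresentations.LubinTate
  Literature.NumberTheory.GaloisCohomology Literature.NumberTheory.EllipticCurves Literature.NumberTheory.EllipticCurves.FormalGroupChart
  Literature.NumberTheory.PAdicHodge.GaloisContinuity Literature.IUT.LogVolume Literature.RingTheory.FormalGroups
  Literature.AlgebraicGeometry.Resolution _root_.WeierstrassCurve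
  Literature.NumberTheory.EllipticCurves.Rank1Residual Literature.NumberTheory.DiophantineGeometry Rat.HeightOneSpectrum
  Summit.BirchSwinnertonDyer.Rank1Residual Summit.BirchSwinnertonDyer.Rank1Residual.Additive
  Summit.BirchSwinnertonDyer.BirchSwinnertonDyer.Theorems.StarredOptimalManinUnitFiveSevenSupersingularCellsModels
  Summit.BirchSwinnertonDyer.BirchSwinnertonDyer.Theorems.StarredOptimalManinUnitFiveSevenOrdinaryCellsModels

namespace Summit.BirchSwinnertonDyer.BirchSwinnertonDyer.Theorems.OrdinaryPotGoodModelsAnyPrime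

variable (W : WeierstrassCurve ℚ) [W.IsElliptic] [W.IsGloballyMinimal] (p : ℕ) [hp : Fact p.Prime]

set_option maxHeartbeats 1600000 in
/-- ★★★ **The good `𝒪_D`-model of a potentially good ORDINARY curve over `F = K_{v′}` with all its reduction data, ANY prime `p ≥ 5`.**
For `W/ℚ` globally minimal, `p ≥ 5`, `ord_p j(W) ≥ 0`, numerology `(e, k, m, n, r₄, r₆, t₄, t₆)` (`e m = 4k + r₄`, `e n = 6k + r₆`, `3r₄ = e t₄`, `2r₆ = e t₆`,
`3m = ord_p Δ_min + t₄`, `2n = ord_p Δ_min + t₆`, `t₄ ≤ 2`, `t₆ ≤ 1`) on the ORDINARY PATTERN with DEURING's congruence — `r₄ = t₄ = 0 < t₆ ∧ p ≡ 1 (mod 4)`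
(CM fibre `y² = x³ + a x`) or `r₆ = t₆ = 0 < t₄ ∧ p ≡ 1 (mod 3)` (CM fibre `y² = x³ + b`) —, a number field `K ∋ α`, `α^e = p`, and a place `v′ ∋ p`: there are an
Eisenstein datum `D` of `F` with `D.poly = X^e − p`, a model `W_D = ⟨0, 0, 0, a·ϱ^{r₄}, b·ϱ^{r₆}⟩` over `𝒪_D` (`a = −27A`, `b = −54B ∈ ℤ`), a bridge `ψ : 𝒪_D → 𝒪_F`
and a variable change `C` over `F` with `C • (W ⊗ F) = curveFO F (W_D ⊗_ψ 𝒪_F)`, such that `Δ(W_D ⊗_ψ 𝒪_F)` is a unit, `A_p(W_D ⊗_ψ 𝒪_F mod 𝔪_F) ≠ 0`,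
`[Xᵖ][p]_{W_D ⊗_ψ 𝒪_F}` maps to a unit of `𝒪_{ℂ_F}`, and the CM fibre `E₀ = ⟨0,0,0, [r₄ = 0]a, [r₆ = 0]b⟩/ℤ` has `W_D ≡ E₀ (mod ϱ)`, `p ∤ Δ(E₀)`,
`A_p(E₀ mod p) ≠ 0`, `p ∤ a_p(E₀)`, `‖a_p(E₀)‖_p = 1`, `a_p(E₀)² < 4p`. VERBATIM `…OrdinaryCellsModels.exists_goodModelData_of_ordinary_numerology` (edix-p4 g29)
with `(hp57, h5, h7)` replaced by `(hp5, hpat)`; the CM-fibre data from `PAdicHodge.CMFibreGoodOrdinaryDataAnyPrime` (Deuring for `j ∈ {0, 1728}`).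
[cite: SilvermanAEC2009, VII.5.5, IV.4.4, V.1.1, V.4.1 and Ex. V.4.4–4.5] [cite: Serre1972, §1.11] -/
theorem exists_goodModelData_of_ordinary_numerology_anyPrime (hp5 : 5 ≤ p) (hj : 0 ≤ padicValRat p W.j)
    {e k m n r₄ r₆ t₄ t₆ : ℕ} (he : 0 < e) (hem : e * m = 4 * k + r₄) (hen : e * n = 6 * k + r₆)
    (h₄ : 3 * r₄ = e * t₄) (h₆ : 2 * r₆ = e * t₆)
    (hm : 3 * m = padicValInt p W.minimalDiscriminantInt + t₄) (hn : 2 * n = padicValInt p W.minimalDiscriminantInt + t₆)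
    (ht₄ : t₄ ≤ 2) (ht₆ : t₆ ≤ 1) (hpat : r₄ = 0 ∧ t₄ = 0 ∧ 0 < t₆ ∧ p % 4 = 1 ∨ r₆ = 0 ∧ t₆ = 0 ∧ 0 < t₄ ∧ p % 3 = 1)
    {K : Type} [Field K] [NumberField K] {α : K} (hαe : α ^ e = (p : K))
    (v' : HeightOneSpectrum (𝓞 K))
    [CharZero (v'.adicCompletion K)]
    (hp' : valuation (v'.adicCompletion K) ((p : ℕ) : v'.adicCompletion K) < 1) :
    ∃ (D : EisensteinRoot (v'.adicCompletion K) p hp') (_ : D.poly = X ^ e - C (p : ℤ_[p])) (a b : ℤ)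
      (Wm : WeierstrassCurve (EisensteinRoot.CoeffDisc D)) (ψ₀ : EisensteinRoot.CoeffDisc D →+* LTCoeff (v'.adicCompletion K))
      (Cv : VariableChange (v'.adicCompletion K)),
      (∀ c, algebraMap (LTCoeff (v'.adicCompletion K)) (v'.adicCompletion K) (ψ₀ c) = EisensteinRoot.CoeffDisc.toF D c) ∧
      Wm = ⟨0, 0, 0, algebraMap ℤ (EisensteinRoot.CoeffDisc D) a * EisensteinRoot.CoeffDisc.of D (AdjoinRoot.root D.poly) ^ r₄,
        algebraMap ℤ (EisensteinRoot.CoeffDisc D) b * EisensteinRoot.CoeffDisc.of D (AdjoinRoot.root D.poly) ^ r₆⟩ ∧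
      IsUnit (64 * (a : ℤ_[p]) ^ 3 * (p : ℤ_[p]) ^ t₄ + 432 * (b : ℤ_[p]) ^ 2 * (p : ℤ_[p]) ^ t₆) ∧
      Cv • W.baseChange (v'.adicCompletion K) = AinfTop.curveFO (v'.adicCompletion K) (Wm.map ψ₀) ∧
      IsUnit (Wm.map ψ₀).Δ ∧
      ((Wm.map ψ₀).map (AinfTop.redCoeff (v'.adicCompletion K))).hasseCoeff p ≠ 0 ∧
      IsUnit (algebraMap (LTCoeff (v'.adicCompletion K)) (CBall (v'.adicCompletion K)) (PowerSeries.coeff p ((Wm.map ψ₀).formalMul p))) ∧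
      Wm.map (Ideal.Quotient.mk (Ideal.span {EisensteinRoot.CoeffDisc.of D (AdjoinRoot.root D.poly)})) =
        ((⟨0, 0, 0, if r₄ = 0 then a else 0, if r₆ = 0 then b else 0⟩ : WeierstrassCurve ℤ).map
          (algebraMap ℤ (EisensteinRoot.CoeffDisc D))).map (Ideal.Quotient.mk (Ideal.span {EisensteinRoot.CoeffDisc.of D (AdjoinRoot.root D.poly)})) ∧
      ¬ (p : ℤ) ∣ ((⟨0, 0, 0, if r₄ = 0 then a else 0, if r₆ = 0 then b else 0⟩ : WeierstrassCurve ℤ)).Δ ∧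
      (((⟨0, 0, 0, if r₄ = 0 then a else 0, if r₆ = 0 then b else 0⟩ : WeierstrassCurve ℤ).map (Int.castRingHom (ZMod p)))).hasseCoeff p ≠ 0 ∧
      ¬ (p : ℤ) ∣ HasseManin.tr (((⟨0, 0, 0, if r₄ = 0 then a else 0, if r₆ = 0 then b else 0⟩ : WeierstrassCurve ℤ).map (Int.castRingHom (ZMod p)))) ∧
      ‖((HasseManin.tr (((⟨0, 0, 0, if r₄ = 0 then a else 0, if r₆ = 0 then b else 0⟩ : WeierstrassCurve ℤ).map (Int.castRingHom (ZMod p)))) : ℤ) :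
          ℤ_[p])‖ = 1 ∧
      HasseManin.tr (((⟨0, 0, 0, if r₄ = 0 then a else 0, if r₆ = 0 then b else 0⟩ : WeierstrassCurve ℤ).map (Int.castRingHom (ZMod p)))) ^ 2 <
        4 * p := by
  have hpr : p.Prime := hp.out
  have hp2 : p ≠ 2 := by omega
  -- the ORDINARY pattern in the shapes used below
  have ht : t₄ = 0 ∧ 0 < t₆ ∨ 0 < t₄ ∧ t₆ = 0 := hpat.imp (fun h => ⟨h.2.1, h.2.2.1⟩) (fun h => ⟨h.2.2.1, h.2.1⟩)
  have hrc : r₄ = 0 ∧ 0 < r₆ ∧ p % 4 = 1 ∨ 0 < r₄ ∧ r₆ = 0 ∧ p % 3 = 1 := by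
    rcases hpat with ⟨hr₄, -, ht₆, hp4⟩ | ⟨hr₆, -, ht₄', hp3⟩
    · refine Or.inl ⟨hr₄, ?_, hp4⟩
      rcases Nat.eq_zero_or_pos r₆ with h0 | h0
      · exfalso; rw [h0, mul_zero] at h₆; have := Nat.mul_pos he ht₆; omega
      · exact h0
    · refine Or.inr ⟨?_, hr₆, hp3⟩
      rcases Nat.eq_zero_or_pos r₄ with h0 | h0
      · exfalso; rw [h0, mul_zero] at h₄; have := Nat.mul_pos he ht₄'; omega
      · exact h0
  have hrr : r₄ = 0 ∧ 0 < r₆ ∨ 0 < r₄ ∧ r₆ = 0 := hrc.imp (fun h => ⟨h.1, h.2.1⟩) (fun h => ⟨h.1, h.2.1⟩)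
  -- §1 the cell numerology (verbatim from `…GoodModelFormula.exists_goodModel_formula_of_numerology`)
  set V := integralModelInt W with hV
  set vΔ := padicValInt p W.minimalDiscriminantInt with hvΔ
  obtain ⟨A, hA⟩ := pow_dvd_c₄_of_padicValRat_j_nonneg W p hj (m := m) (by omega)
  obtain ⟨B, hB⟩ := pow_dvd_c₆_of_padicValRat_j_nonneg W p hj (n := n) (by omega)
  have hΔ0 : V.Δ ≠ 0 := minimalDiscriminantInt_ne_zero W
  obtain ⟨dd, hd⟩ : (p : ℤ) ^ vΔ ∣ V.Δ := (padicValInt_dvd_iff _ _).2 (Or.inr le_rfl)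
  have hpd : ¬ (p : ℤ) ∣ dd := by
    rintro ⟨d', rfl⟩
    have : (p : ℤ) ^ (vΔ + 1) ∣ V.Δ := ⟨d', by rw [hd, pow_succ]; ring⟩
    rcases (padicValInt_dvd_iff _ _).1 this with h | h
    · exact hΔ0 h
    · have h' : vΔ + 1 ≤ vΔ := h
      omega
  have hid := unit_identity (q := (p : ℤ)) (by exact_mod_cast hpr.ne_zero) hA.symm hB.symm hd.symm V.c_relation hm hn
  have hz : ¬ (p : ℤ) ∣ -(6 ^ 12 * dd) := by
    rw [dvd_neg]
    intro h
    rcases (Nat.prime_iff_prime_int.mp hpr).dvd_or_dvd h with h6 | h6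
    · have hp6 : (p : ℤ) ∣ 6 := Int.Prime.dvd_pow' hpr h6
      have h6' : p ∣ 2 * 3 := by exact_mod_cast hp6
      rcases (Nat.Prime.dvd_mul hpr).mp h6' with h | h
      · have := Nat.le_of_dvd two_pos h; omega
      · have := Nat.le_of_dvd three_pos h; omega
    · exact hpd h6
  have hU : ¬ (p : ℤ) ∣ 64 * (-27 * A) ^ 3 * (p : ℤ) ^ t₄ + 432 * (-54 * B) ^ 2 * (p : ℤ) ^ t₆ := by rwa [hid]
  have hunit : IsUnit (64 * (-27 * (A : ℤ_[p])) ^ 3 * (p : ℤ_[p]) ^ t₄ + 432 * (-54 * (B : ℤ_[p])) ^ 2 * (p : ℤ_[p]) ^ t₆) := by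
    have hu : IsUnit (((-(6 ^ 12 * dd) : ℤ)) : ℤ_[p]) := by
      rw [PadicInt.isUnit_iff]
      exact le_antisymm (PadicInt.norm_le_one _) (not_lt.1 fun h => hz ((PadicInt.norm_int_lt_one_iff_dvd _).1 h))
    rw [← hid] at hu
    push_cast at hu
    exact hu
  have hunit' : IsUnit (64 * (((-27 * A : ℤ) : ℤ_[p])) ^ 3 * (p : ℤ_[p]) ^ t₄ + 432 * (((-54 * B : ℤ) : ℤ_[p])) ^ 2 * (p : ℤ_[p]) ^ t₆) := by
    push_cast
    exact hunit
  have hα0 : α ≠ 0 := by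
    intro h0; rw [h0, zero_pow he.ne'] at hαe; exact (Nat.cast_ne_zero.2 hpr.ne_zero) hαe.symm
  -- §2 the `K`-model `S ≅ W ×_ℚ K`
  set S : WeierstrassCurve K := ⟨0, 0, 0, -27 * (V.c₄ : K) / (α ^ k) ^ 4, -54 * (V.c₆ : K) / (α ^ k) ^ 6⟩ with hS
  have hWK : W.baseChange K = V.map (Int.castRingHom K) := by
    rw [WeierstrassCurve.baseChange, ← map_integralModelInt W, WeierstrassCurve.map_map]
    congr 1
    exact RingHom.ext_int _ _
  have hc4K : (W.baseChange K).c₄ = (V.c₄ : K) := by rw [hWK, WeierstrassCurve.map_c₄, eq_intCast]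
  have hc6K : (W.baseChange K).c₆ = (V.c₆ : K) := by rw [hWK, WeierstrassCurve.map_c₆, eq_intCast]
  have h6 : (6 : K) ≠ 0 := by norm_num
  obtain ⟨C, hC⟩ := exists_variableChange_eq_short (L := K) two_ne_zero three_ne_zero (W.baseChange K)
    (u := α ^ k / 6) (div_ne_zero (pow_ne_zero _ hα0) h6)
  have e4 : -(V.c₄ : K) / (48 * (α ^ k / 6) ^ 4) = -27 * (V.c₄ : K) / (α ^ k) ^ 4 := by
    have : (α ^ k) ≠ 0 := pow_ne_zero _ hα0
    field_simp
    ring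
  have e6 : -(V.c₆ : K) / (864 * (α ^ k / 6) ^ 6) = -54 * (V.c₆ : K) / (α ^ k) ^ 6 := by
    have : (α ^ k) ≠ 0 := pow_ne_zero _ hα0
    field_simp
    ring
  have hC' : C • W.baseChange K = S := by rw [hC, hS, hc4K, hc6K, e4, e6]
  -- §3 over `F = K_{v′}`: `ϖ = α`, `D = (X^e − p, ϖ)`, `ψ : 𝒪_D → 𝒪_F`, the good model `W_D`
  obtain ⟨ϖ, hϖ⟩ : ∃ ϖ : v'.adicCompletion K, ϖ = algebraMap K (v'.adicCompletion K) α := ⟨_, rfl⟩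
  have hϖe : ϖ ^ e = (p : v'.adicCompletion K) := by rw [hϖ, ← map_pow, hαe, map_natCast]
  have hϖ0 : ϖ ≠ 0 := by rw [hϖ]; exact (_root_.map_ne_zero _).2 hα0
  obtain ⟨D, hD, hDroot⟩ := EisensteinRoot.exists_poly_eq_X_pow_sub_C hp' he hϖe
  have hroot := D.root_pow_eq_of_poly_eq hD
  obtain ⟨ψ₀, hψ₀⟩ : ∃ ψ₀ : EisensteinRoot.CoeffDisc D →+* LTCoeff (v'.adicCompletion K),
      ∀ c, algebraMap (LTCoeff (v'.adicCompletion K)) (v'.adicCompletion K) (ψ₀ c) = EisensteinRoot.CoeffDisc.toF D c := by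
    obtain ⟨β, hβ⟩ := EisensteinRoot.exists_coeffToLTCoeff D
    exact ⟨β.comp (EisensteinRoot.CoeffDisc.of D).symm.toRingHom, fun c => hβ _⟩
  haveI : CharP 𝓀[v'.adicCompletion K] p := charP_residueField_of_valuation_lt_one hp'
  -- the model over `𝒪_D` (both presentations) and its reduction data
  set WD : WeierstrassCurve D.Coeff := ⟨0, 0, 0, AdjoinRoot.of D.poly ((-27 * A : ℤ) : ℤ_[p]) * AdjoinRoot.root D.poly ^ r₄,
      AdjoinRoot.of D.poly ((-54 * B : ℤ) : ℤ_[p]) * AdjoinRoot.root D.poly ^ r₆⟩ with hWD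
  set Wm : WeierstrassCurve (EisensteinRoot.CoeffDisc D) := WD.map (EisensteinRoot.CoeffDisc.of D).toRingHom with hWm
  have hWmψ : Wm.map ψ₀ = WD.map (ψ₀.comp (EisensteinRoot.CoeffDisc.of D).toRingHom) := by rw [hWm, WeierstrassCurve.map_map]
  have hΔ : IsUnit (Wm.map ψ₀).Δ := by
    rw [hWmψ]; exact AinfTop.isUnit_Δ_map_model (F := v'.adicCompletion K) hD (ψ₀.comp (EisensteinRoot.CoeffDisc.of D).toRingHom) _ _ h₄ h₆ hunit'
  have hHasse : ((Wm.map ψ₀).map (AinfTop.redCoeff (v'.adicCompletion K))).hasseCoeff p ≠ 0 := by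
    rw [hWmψ]
    exact AinfTop.hasseCoeff_red_map_model_ne_zero_of_isUnit_anyPrime hD (ψ₀.comp (EisensteinRoot.CoeffDisc.of D).toRingHom) _ _ hp5 he h₄ h₆
      hpat hunit'
  have h1 : IsUnit (algebraMap (LTCoeff (v'.adicCompletion K)) (CBall (v'.adicCompletion K))
      (PowerSeries.coeff p ((Wm.map ψ₀).formalMul p))) :=
    AinfTop.isUnit_algebraMap_coeff_prime_formalMul_of_hasseCoeff_red_ne_zero _ hp2 hHasse
  -- `E := (W_D ⊗_ψ 𝒪_F) ⊗ F = W_D ⊗_{𝒪_D} F = S ⊗ F = (C ⊗ F) • (W ⊗ F)`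
  have hEWD : AinfTop.curveFO (v'.adicCompletion K) (Wm.map ψ₀) = WD.map (EisensteinRoot.Coeff.toF D) := by
    rw [hWm]; exact AinfRamTop.curveFO_map_of_map_ψ WD ψ₀ hψ₀
  have hSF : S.baseChange (v'.adicCompletion K) = WD.map (EisensteinRoot.Coeff.toF D) := by
    rw [hWD, map_model_toF, hDroot]
    have hp4 : (ϖ ^ k) ^ 4 * ϖ ^ r₄ = (p : v'.adicCompletion K) ^ m := by
      rw [← pow_mul, ← pow_add, show k * 4 + r₄ = e * m by omega, pow_mul, hϖe]
    have hp6 : (ϖ ^ k) ^ 6 * ϖ ^ r₆ = (p : v'.adicCompletion K) ^ n := by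
      rw [← pow_mul, ← pow_add, show k * 6 + r₆ = e * n by omega, pow_mul, hϖe]
    have hc4F : ((V.c₄ : ℤ) : v'.adicCompletion K) = (ϖ ^ k) ^ 4 * ϖ ^ r₄ * (A : v'.adicCompletion K) := by
      rw [hp4, hA]; push_cast; ring
    have hc6F : ((V.c₆ : ℤ) : v'.adicCompletion K) = (ϖ ^ k) ^ 6 * ϖ ^ r₆ * (B : v'.adicCompletion K) := by
      rw [hp6, hB]; push_cast; ring
    have hϖk : ϖ ^ k ≠ 0 := pow_ne_zero _ hϖ0
    have ha4 : algebraMap K (v'.adicCompletion K) (-27 * (V.c₄ : K) / (α ^ k) ^ 4) =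
        zpToF hp' ((-27 * A : ℤ) : ℤ_[p]) * ϖ ^ r₄ := by
      rw [map_div₀, map_mul, map_neg, map_ofNat, map_intCast, map_pow, map_pow, ← hϖ, map_intCast, hc4F]
      field_simp
      push_cast
      ring
    have ha6 : algebraMap K (v'.adicCompletion K) (-54 * (V.c₆ : K) / (α ^ k) ^ 6) =
        zpToF hp' ((-54 * B : ℤ) : ℤ_[p]) * ϖ ^ r₆ := by
      rw [map_div₀, map_mul, map_neg, map_ofNat, map_intCast, map_pow, map_pow, ← hϖ, map_intCast, hc6F]
      field_simp
      push_cast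
      ring
    exact WeierstrassCurve.ext (map_zero _) (map_zero _) (map_zero _) ha4 ha6
  have hWKF : (W.baseChange K).baseChange (v'.adicCompletion K) = W.baseChange (v'.adicCompletion K) :=
    (W.map_baseChange (IsScalarTower.toAlgHom ℚ K (v'.adicCompletion K)))
  have hCE : (C.map (algebraMap K (v'.adicCompletion K))) • W.baseChange (v'.adicCompletion K) =
      AinfTop.curveFO (v'.adicCompletion K) (Wm.map ψ₀) := by
    rw [hEWD, ← hSF, ← hC', ← hWKF]
    simp only [WeierstrassCurve.baseChange, WeierstrassCurve.map_variableChange]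
  -- §4 the CM fibre `E₀` and its ORDINARY data
  set a : ℤ := -27 * A with ha
  set b : ℤ := -54 * B with hb
  have hWmE : Wm = ⟨0, 0, 0, algebraMap ℤ (EisensteinRoot.CoeffDisc D) a * EisensteinRoot.CoeffDisc.of D (AdjoinRoot.root D.poly) ^ r₄,
      algebraMap ℤ (EisensteinRoot.CoeffDisc D) b * EisensteinRoot.CoeffDisc.of D (AdjoinRoot.root D.poly) ^ r₆⟩ := by
    rw [hWm, hWD]
    refine WeierstrassCurve.ext (map_zero _) (map_zero _) (map_zero _) ?_ ?_ <;>
    · simp only [WeierstrassCurve.map, RingEquiv.toRingHom_eq_coe, RingHom.coe_coe, map_mul, map_pow, map_intCast, eq_intCast]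
  have hWE : Wm.map (Ideal.Quotient.mk (Ideal.span {EisensteinRoot.CoeffDisc.of D (AdjoinRoot.root D.poly)})) =
      (((⟨0, 0, 0, if r₄ = 0 then a else 0, if r₆ = 0 then b else 0⟩ : WeierstrassCurve ℤ)).map (algebraMap ℤ (EisensteinRoot.CoeffDisc D))).map
        (Ideal.Quotient.mk (Ideal.span {EisensteinRoot.CoeffDisc.of D (AdjoinRoot.root D.poly)})) := by
    rw [hWmE]; exact map_explicitModel_eq_map_cmFibre D a b r₄ r₆
  have hunitab : IsUnit (64 * (a : ℤ_[p]) ^ 3 * (p : ℤ_[p]) ^ t₄ + 432 * (b : ℤ_[p]) ^ 2 * (p : ℤ_[p]) ^ t₆) := by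
    rw [ha, hb]; exact hunit'
  obtain ⟨hta, htb⟩ := not_dvd_of_isUnit_ord a b hp5 ht hunitab
  have ha' : r₄ = 0 → ¬ (p : ℤ) ∣ a := fun hr₄ => hta (by
    rcases Nat.eq_zero_or_pos t₄ with h | h
    · exact h
    · exfalso; rw [hr₄, mul_zero] at h₄; have := Nat.mul_pos he h; omega)
  have hb' : r₆ = 0 → ¬ (p : ℤ) ∣ b := fun hr₆ => htb (by
    rcases Nat.eq_zero_or_pos t₆ with h | h
    · exact h
    · exfalso; rw [hr₆, mul_zero] at h₆; have := Nat.mul_pos he h; omega)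
  refine ⟨D, hD, a, b, Wm, ψ₀, C.map (algebraMap K (v'.adicCompletion K)), hψ₀, hWmE, hunitab, hCE, hΔ, hHasse, h1, hWE,
    not_dvd_Δ_cmFibre_ord_anyPrime a b r₄ r₆ hp5 hrr ha' hb', hasseCoeff_cmFibre_ne_zero_anyPrime a b r₄ r₆ hrc ha' hb',
    not_dvd_tr_cmFibre_anyPrime a b r₄ r₆ hp5 hrc ha' hb', norm_intCast_tr_cmFibre_eq_one_anyPrime a b r₄ r₆ hp5 hrc ha' hb',
    tr_cmFibre_sq_lt_four_mul_anyPrime a b r₄ r₆ hp5 hrr ha' hb'⟩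

end Summit.BirchSwinnertonDyer.BirchSwinnertonDyer.Theorems.OrdinaryPotGoodModelsAnyPrime

end
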